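import Mathlib
import HarnessLib
import Summits.ValiantsHypothesis.ValiantsHypothesis.Theses.MonotoneRestoration
import Literature.Computability.AlgebraicComplexity.BlaserJindalSymmetric
import Literature.Computability.AlgebraicComplexity.ValiantClasses
import Literature.Computability.AlgebraicComplexity.ArithCircuitProofs
import Literature.Computability.AlgebraicComplexity.BurgisserTransferProofs
import Literature.Computability.AlgebraicComplexity.SymmetricCircuitPairing
import Literature.Computability.AlgebraicComplexity.SymmetricCircuitScaledInputs
import Literature.Computability.AlgebraicComplexity.SymmetricCircuitConstOutputs
import Literature.Computability.AlgebraicComplexity.SymmetricCircuitLinCombOutputsSymmetry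
import Literature.Computability.AlgebraicComplexity.SymmetricCircuitFold
import Summits.ValiantsHypothesis.ValiantsHypothesis.Theorems.MonotoneRestorationMonotoneRestorationQPZetaHomogeneous
import Summits.ValiantsHypothesis.ValiantsHypothesis.Theorems.MonotoneRestorationMonotoneRestorationQPZetaGenerators
import Summits.ValiantsHypothesis.ValiantsHypothesis.Theorems.MonotoneRestorationMonotoneRestorationQPZetaPatterns

/-! # Route MonotoneRestoration — crux `MonotoneRestorationQP`, line Sketch v10: THEOREM ζ-E
(stmt-ValiantsHypothesis-15886, lead c5)

**The reflection-group regime restores (conditional on Bläser–Jindal): `VP` families symmetric in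
ALL matrix entries have polynomial-size square-symmetric circuits.**
Census T1 of the crux records that Bläser–Jindal's restoration of symmetry breaks "at line one"
for the MATRIX action `S_n × S_n` because the invariant ring is not a polynomial ring; this file
makes the positive half of that remark a theorem of the tree: for the FULL symmetric group of the
`n²` entries (a reflection group: invariants = `ℂ[e_1, …, e_{n²}]`) restoration holds, by

* the fundamental theorem of symmetric polynomials (Mathlib `MvPolynomial.esymmAlgEquiv`):
  `f_n = F_n(e_1, …, e_{n²})` for a unique witness `F_n`;
* Bläser–Jindal 2019, Thm 4 (named fact `BlaserJindal2019_thm4`): `complexity F_n` is polynomial in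
  `complexity f_n`, `deg f_n`, `n²`;
* `zeta_symmetric_esymm`: every `e_k` of the entries has a square-symmetric circuit of size
  `(n²+2)(9n²+15)` — the `k`-th homogeneous component (THEOREM ζ-H) of `Π_ij (1 + x_ij)`
  (constants Z8 + scaled inputs Z2 + linear combination Z5 + orbit product Z3);
* THEOREM ζ-G (`zeta_symmetric_of_invariantGenerators_complexity`): the witness program on top of
  the generator circuits is a symmetric circuit.

* `qpSymmetric_of_entrySymmetric` — COROLLARY AT THE CRUX'S SCALE (registered; conditional on the
  named fact): entry-symmetric `VP` families satisfy the conclusion of `MonotoneRestorationQP`.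
-/

noncomputable section

-- `Summit.ValiantsHypothesis.ValiantsHypothesis.…` is the tree's mandated namespace (Sub = Summit).
set_option linter.dupNamespace false

namespace Summit.ValiantsHypothesis.ValiantsHypothesis.Theorems

open Literature.Computability.AlgebraicComplexity

/-! ### The product `Π_x (1 + x)` and the elementary symmetric polynomials of the entries -/

/-- **`Π_x (1 + x)` symmetrically.** For a finite nonempty `Γ`-set of variables `X`, the product
`Π_{x ∈ X} (1 + x)` is computed by a `Γ`-symmetric single-output circuit on at most `7|X| + 6` gates
(constant family `1`, scaled inputs, entrywise sum, orbit product). [folklore] -/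
theorem zeta_symmetric_prod_one_add {K X Γ : Type} [CommSemiring K] [Group Γ] [MulAction Γ X]
    [MulAction Γ Unit] [Fintype X] [DecidableEq X] [Nonempty X] :
    ∃ (G : Type) (_ : Fintype G) (C : LabelledArithCircuit K X Unit G),
      C.IsSymmetric Γ ∧ C.eval (C.output ()) = ∏ x : X, (1 + MvPolynomial.X x) ∧
      Fintype.card G ≤ 7 * Fintype.card X + 6 := by
  obtain ⟨G₁, i₁, C₁, h₁, hev₁, hc₁⟩ := LabelledArithCircuit.exists_constOutputs (K := K) X
    (Γ := Γ) (fun _ : X => (1 : K)) (fun _ _ => rfl)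
  obtain ⟨G₂, i₂, C₂, h₂, hev₂, hc₂⟩ :=
    LabelledArithCircuit.exists_scaledInputs (K := K) (X := X) Γ 1
  obtain ⟨G₀, i₀, C₀, h₀, hinl, hinr, hc₀⟩ := h₁.exists_pairing h₂
  obtain ⟨G₃, i₃, C₃, h₃, hev₃, hc₃⟩ := h₀.exists_linCombOutputs C₀ 1 1
  obtain ⟨G, inst, C, hC, hev, hc⟩ := h₃.exists_prodOutputs
  refine ⟨G, inst, C, hC, ?_, by omega⟩
  rw [hev]
  refine Finset.prod_congr rfl fun x _ => ?_
  rw [hev₃, hinl, hinr, hev₁, hev₂, map_one, one_mul, one_mul, one_mul]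

/-- `Π_x (1 + x) = Σ_k e_k`. [folklore] -/
theorem zeta_prod_one_add_eq_sum_esymm (K X : Type) [CommSemiring K] [Fintype X] [DecidableEq X] :
    ∏ x : X, (1 + MvPolynomial.X x : MvPolynomial X K) =
      ∑ k ∈ Finset.range (Fintype.card X + 1), MvPolynomial.esymm X K k := by
  rw [Finset.prod_one_add, Finset.powerset_card_disjiUnion, Finset.sum_disjiUnion,
    Finset.card_univ]
  rfl

/-- `e_k` is homogeneous of degree `k`. [folklore] -/
theorem zeta_esymm_isHomogeneous (K X : Type) [CommSemiring K] [Fintype X] [DecidableEq X] (k : ℕ) :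
    (MvPolynomial.esymm X K k).IsHomogeneous k := by
  unfold MvPolynomial.esymm
  refine MvPolynomial.IsHomogeneous.sum _ _ _ fun t ht => ?_
  have hk : t.card = k := (Finset.mem_powersetCard.1 ht).2
  have h := MvPolynomial.IsHomogeneous.prod t (fun i => (MvPolynomial.X i : MvPolynomial X K))
    (fun _ => 1) fun i _ => MvPolynomial.isHomogeneous_X K i
  rwa [Finset.sum_const, smul_eq_mul, mul_one, hk] at h

/-- The `k`-th homogeneous component of `Π_x (1 + x)` is `e_k`. [folklore] -/
theorem zeta_homogeneousComponent_prod_one_add (K X : Type) [CommSemiring K] [Fintype X]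
    [DecidableEq X] (k : ℕ) :
    MvPolynomial.homogeneousComponent k (∏ x : X, (1 + MvPolynomial.X x : MvPolynomial X K)) =
      MvPolynomial.esymm X K k := by
  rw [zeta_prod_one_add_eq_sum_esymm, map_sum]
  have hj : ∀ j, MvPolynomial.homogeneousComponent k (MvPolynomial.esymm X K j) =
      if k = j then MvPolynomial.esymm X K j else 0 := fun j =>
    MvPolynomial.homogeneousComponent_of_mem
      ((MvPolynomial.mem_homogeneousSubmodule _ _).2 (zeta_esymm_isHomogeneous K X j))
  simp only [hj]
  rw [Finset.sum_ite_eq]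
  split_ifs with h
  · rfl
  · -- `k > |X|`: `e_k = 0`
    rw [Finset.mem_range, not_lt] at h
    rw [MvPolynomial.esymm, Finset.powersetCard_eq_empty.2 (by rw [Finset.card_univ]; omega),
      Finset.sum_empty]

/-- **The elementary symmetric polynomials of the entries, symmetrically.** Over a field of
characteristic `0`, for a finite nonempty `Γ`-set of variables `X` and every `k`, `e_k(X)` is
computed by a `Γ`-symmetric single-output circuit on at most `(|X| + 2)(9|X| + 15)` gates (ζ-H on
`Π_x (1 + x)`, which has degree `≤ |X|`). [folklore] -/
theorem zeta_symmetric_esymm {K X Γ : Type} [Field K] [CharZero K] [Group Γ] [MulAction Γ X]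
    [MulAction Γ Unit] [Fintype X] [DecidableEq X] [Nonempty X] (k : ℕ) :
    ∃ (G : Type) (_ : Fintype G) (C : LabelledArithCircuit K X Unit G),
      C.IsSymmetric Γ ∧ C.eval (C.output ()) = MvPolynomial.esymm X K k ∧
      Fintype.card G ≤ (Fintype.card X + 2) * (9 * Fintype.card X + 15) := by
  obtain ⟨G₁, i₁, C₁, h₁, hev₁, hc₁⟩ := zeta_symmetric_prod_one_add (K := K) (X := X) (Γ := Γ)
  have hdeg : (C₁.eval (C₁.output ())).totalDegree ≤ Fintype.card X := by
    rw [hev₁]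
    refine (MvPolynomial.totalDegree_finsetProd _ _).trans ?_
    calc ∑ x : X, (1 + MvPolynomial.X x : MvPolynomial X K).totalDegree ≤ ∑ _x : X, 1 :=
          Finset.sum_le_sum fun x _ => (MvPolynomial.totalDegree_add _ _).trans
            (max_le (by simp) (MvPolynomial.totalDegree_X (R := K) x).le)
      _ = Fintype.card X := by simp
  obtain ⟨G, inst, C, hC, hev, hc⟩ := zeta_symmetric_homogeneousComponent C₁ h₁ hdeg k
  refine ⟨G, inst, C, hC, by rw [hev, hev₁, zeta_homogeneousComponent_prod_one_add], hc.trans ?_⟩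
  have := Nat.mul_le_mul_left (Fintype.card X + 2)
    (show Fintype.card G₁ + 2 * Fintype.card X + 9 ≤ 9 * Fintype.card X + 15 by omega)
  exact this

/-! ### The entry-symmetric slice -/

/-- **THEOREM ζ-E — THE REFLECTION-GROUP REGIME RESTORES (conditional on Bläser–Jindal 2019,
Thm 4).** Assume the named fact `BlaserJindal2019_thm4` (the witness `F` of a symmetric polynomial
`F(e_1, …, e_N)` has complexity polynomial in that of the symmetric polynomial, its degree and
`N`). Then every family `f_n ∈ ℂ[x_ij : i, j < n]` that is invariant under ALL permutations of the
`n²` entries and is a `VP` family (`IsVPFamily`) has square-symmetric circuits of quasi-polynomial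
(indeed polynomial) size: the conclusion of `MonotoneRestorationQP` holds on the entry-symmetric
slice. Proof: fundamental theorem (`esymmAlgEquiv`) + BJ for the witness + `zeta_symmetric_esymm`
for the generators + THEOREM ζ-G. What the crux asks beyond this is exactly the passage from the
matrix-symmetric invariant ring (NOT generated by algebraically independent symmetric-cheap
generators) to such a presentation. [cite: BlaserJindal2019, Thm. 4] -/
theorem qpSymmetric_of_entrySymmetric :
    BlaserJindal2019_thm4 →
    ∀ (f : (n : ℕ) → MvPolynomial (Fin n × Fin n) ℂ),
      (∀ (n : ℕ) (π : Equiv.Perm (Fin n × Fin n)), MvPolynomial.rename π (f n) = f n) →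
      IsVPFamily f →
      ∃ c : ℕ, ∀ n : ℕ, ∃ (G : Type) (_ : Fintype G)
        (C : LabelledArithCircuit ℂ (Fin n × Fin n) Unit G),
        C.IsSymmetric (Equiv.Perm (Fin n)) ∧ C.eval (C.output ()) = f n ∧
          Fintype.card G ≤ 2 ^ ((Nat.log 2 n + c) ^ c) := by
  rintro ⟨cB, hB⟩ f hsym ⟨⟨-, ⟨c₂, hdeg⟩⟩, ⟨c₁, hcplx⟩⟩
  -- the polynomial size bound, as a function of `n`
  set K : ℕ := (c₁ + c₂ + 4) * cB + 6 with hK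
  obtain ⟨c₃, hc₃⟩ := zeta_poly_mul_qp_le 67 K 0 0
  refine ⟨c₃, fun n => ?_⟩
  rcases Nat.eq_zero_or_pos n with rfl | hn
  · obtain ⟨G, inst, C, hC, hev, hcard⟩ := zeta_symmetric_constant (X := Fin 0 × Fin 0)
      (Γ := Equiv.Perm (Fin 0)) (MvPolynomial.coeff 0 (f 0))
    refine ⟨G, inst, C, hC, ?_, hcard.trans Nat.one_le_two_pow⟩
    rw [hev]
    exact (MvPolynomial.eq_C_of_isEmpty (f 0)).symm
  · haveI : NeZero n := ⟨by omega⟩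
    haveI : Nonempty (Fin n × Fin n) := ⟨((0 : Fin n), (0 : Fin n))⟩
    set N : ℕ := n * n with hNdef
    have hN : Fintype.card (Fin n × Fin n) = N := by simp [hNdef]
    -- the witness
    have hmem : f n ∈ MvPolynomial.symmetricSubalgebra (Fin n × Fin n) ℂ :=
      (MvPolynomial.mem_symmetricSubalgebra _).2 fun π => hsym n π
    set F : MvPolynomial (Fin N) ℂ :=
      (MvPolynomial.esymmAlgEquiv (Fin n × Fin n) ℂ hN).symm ⟨f n, hmem⟩ with hFdef
    have hF : MvPolynomial.aeval (fun i : Fin N => MvPolynomial.esymm (Fin n × Fin n) ℂ (i + 1)) F =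
        f n := by
      have h1 := congrArg Subtype.val
        ((MvPolynomial.esymmAlgEquiv (Fin n × Fin n) ℂ hN).apply_symm_apply ⟨f n, hmem⟩)
      rw [MvPolynomial.esymmAlgEquiv_apply, MvPolynomial.esymmAlgHom_apply] at h1
      exact h1
    -- Bläser–Jindal for the witness, transported to the variables `Fin N`
    let e : Fin n × Fin n ≃ Fin N := Fintype.equivFinOfCardEq hN
    have hfun : (fun i : Fin N => MvPolynomial.esymm (Fin N) ℂ (i + 1)) =
        fun i : Fin N => MvPolynomial.rename e (MvPolynomial.esymm (Fin n × Fin n) ℂ (i + 1)) :=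
      funext fun i => by rw [MvPolynomial.rename_esymm]
    have hSym : MvPolynomial.aeval (fun i : Fin N => MvPolynomial.esymm (Fin N) ℂ (i + 1)) F =
        MvPolynomial.rename e (f n) := by
      rw [hfun, ← MvPolynomial.comp_aeval, AlgHom.comp_apply, hF]
    have hBF : complexity F ≤ (complexity (f n) + (f n).totalDegree + N + 2) ^ cB := by
      have h := hB N F
      rw [hSym, complexity_rename_of_injective_holds e.injective (f n)] at h
      refine h.trans (Nat.pow_le_pow_left ?_ cB)
      have := MvPolynomial.totalDegree_rename_le (e : Fin n × Fin n → Fin N) (f n)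
      omega
    -- the generators `e_1, …, e_N` of the entries, symmetrically (ζ-H on `Π (1 + x)`)
    set t : ℕ := (N + 2) * (9 * N + 15) with htdef
    have hg : ∀ i : Fin N, ∃ (G : Type) (_ : Fintype G)
        (C : LabelledArithCircuit ℂ (Fin n × Fin n) Unit G),
        C.IsSymmetric (Equiv.Perm (Fin n)) ∧
          C.eval (C.output ()) = MvPolynomial.esymm (Fin n × Fin n) ℂ (i + 1) ∧
          Fintype.card G ≤ t := fun i => by
      obtain ⟨G, inst, C, hC, hev, hc⟩ := zeta_symmetric_esymm (K := ℂ) (X := Fin n × Fin n)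
        (Γ := Equiv.Perm (Fin n)) ((i : ℕ) + 1)
      exact ⟨G, inst, C, hC, hev, by rw [htdef, ← hN]; exact hc⟩
    -- THEOREM ζ-G: the witness program on top of the generator circuits
    obtain ⟨G, inst, C, hC, hev, hcard⟩ :=
      zeta_symmetric_of_invariantGenerators_complexity (Γ := Equiv.Perm (Fin n))
        (fun i : Fin N => MvPolynomial.esymm (Fin n × Fin n) ℂ (i + 1)) t hg F
    refine ⟨G, inst, C, hC, by rw [hev, hF], hcard.trans (le_trans ?_ (hc₃ n))⟩
    -- polynomial bookkeeping: everything is `≤ (n+2)^K`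
    have hb : 1 ≤ n + 2 := by omega
    have hmono : ∀ a b : ℕ, a ≤ b → (n + 2) ^ a ≤ (n + 2) ^ b := fun a b hab =>
      Nat.pow_le_pow_right hb hab
    have h4 : 4 ≤ (n + 2) ^ 2 := by nlinarith
    have hNle : N ≤ (n + 2) ^ 2 := by rw [hNdef]; nlinarith
    have ht : t ≤ 30 * (n + 2) ^ 4 := by
      have h1 : N + 2 ≤ 2 * (n + 2) ^ 2 := by omega
      have h2 : 9 * N + 15 ≤ 15 * (n + 2) ^ 2 := by omega
      calc t = (N + 2) * (9 * N + 15) := htdef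
        _ ≤ (2 * (n + 2) ^ 2) * (15 * (n + 2) ^ 2) := Nat.mul_le_mul h1 h2
        _ = 30 * (n + 2) ^ 4 := by ring
    have hNt : N * t ≤ 30 * (n + 2) ^ K := by
      calc N * t ≤ (n + 2) ^ 2 * (30 * (n + 2) ^ 4) := Nat.mul_le_mul hNle ht
        _ = 30 * (n + 2) ^ 6 := by ring
        _ ≤ 30 * (n + 2) ^ K := Nat.mul_le_mul_left 30 (hmono 6 K (by omega))
    have hS : complexity (f n) + (f n).totalDegree + N + 2 ≤ (n + 2) ^ (c₁ + c₂ + 4) := by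
      have e1 : complexity (f n) ≤ (n + 2) ^ (c₁ + c₂ + 2) :=
        ((hcplx n).trans (pow_add_le_add_two_pow n c₁)).trans (hmono _ _ (by omega))
      have e2 : (f n).totalDegree ≤ (n + 2) ^ (c₁ + c₂ + 2) :=
        ((hdeg n).trans (pow_add_le_add_two_pow n c₂)).trans (hmono _ _ (by omega))
      have e3 : N + 2 ≤ 2 * (n + 2) ^ (c₁ + c₂ + 2) := by
        have := hmono 2 (c₁ + c₂ + 2) (by omega)
        have h22 : 2 ≤ (n + 2) ^ (c₁ + c₂ + 2) := le_trans (by omega) (le_trans h4 this)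
        omega
      calc complexity (f n) + (f n).totalDegree + N + 2 ≤ 4 * (n + 2) ^ (c₁ + c₂ + 2) := by omega
        _ ≤ (n + 2) ^ 2 * (n + 2) ^ (c₁ + c₂ + 2) := Nat.mul_le_mul_right _ h4
        _ = (n + 2) ^ (c₁ + c₂ + 4) := by ring
    have hF' : complexity F ≤ (n + 2) ^ (K - 6) := by
      refine hBF.trans ((Nat.pow_le_pow_left hS cB).trans ?_)
      rw [← pow_mul, hK, Nat.add_sub_cancel]
    have hK6 : (n + 2) ^ (K - 6) ≤ (n + 2) ^ K := hmono _ _ (Nat.sub_le K 6)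
    have hone : 1 ≤ (n + 2) ^ K := Nat.one_le_pow _ _ hb
    have hN' : N ≤ (n + 2) ^ K := hNle.trans (hmono 2 K (by omega))
    simp only [pow_zero, mul_one]
    calc N * t + 18 * (complexity F + 1) + N
        ≤ 30 * (n + 2) ^ K + 18 * ((n + 2) ^ K + (n + 2) ^ K) + (n + 2) ^ K := by
          have := Nat.add_le_add (hF'.trans hK6) hone
          nlinarith
      _ = 67 * (n + 2) ^ K := by ring

end Summit.ValiantsHypothesis.ValiantsHypothesis.Theorems

end
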